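import Mathlib
import Summits.ResolutionOfSingularities.ResolutionOfSingularities.Theorems.HomologicalConductorPersistenceKC3Lower
import Summits.ResolutionOfSingularities.ResolutionOfSingularities.Theorems.HomologicalConductorPersistenceKC3LocalModelTransport
import Summits.ResolutionOfSingularities.ResolutionOfSingularities.Theorems.HomologicalConductorPersistenceKC3Glue
import HarnessLib

/-!
# Crux `Persistence` (stmt-ResolutionOfSingularities-16484), K-C3 §H2L — SOCKET K2 OF THE K5 SKELETON CLOSED:
# `ca(T₀) = (x, y, z², zt, t²)·T₀` at the K-C3 datum, for every field `k` with `2 ≠ 0`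

Route `ResolutionOfSingularities/HomologicalConductor`, chain W4.4b (CHAIN v13.9; K5 skeleton of record `kc3.lean`
426e18cfa946fb83, socket `stub_kc3_ca_loc_eq`; holder of record res-L1-w44b-lead-1). [OURS · L1 w44b] AI-written, weaker
than expert review; NOT a statement of the manuscript under study (Hironaka 2017) and no statement of it is used; no theorem
here concludes the crux.

THE SOCKET. `T₀ = loc O A`, `A = k[x, z, t, (z³+t⁴)x⁻¹] ⊆ K = k(x,z,t)`, `O = O_w` (`w = (6,5,4)`):
`ca (loc O A) = {αx + βy + γz² + δzt + εt² : α, …, ε ∈ loc O A}` (043's `hca` VERBATIM). Assembly of landed pieces only: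
* `⊆` = res-type-010 `KC3Upper.kc3_ca_loc_subset` (K2c, p534738; fact-free conductor/Knörrer-free upper bound of res-D-pv-058 /
  res-type-010 through the algebraic local model);
* `⊇` = the five memberships `x, y, z², zt, t² ∈ ca (loc O A)`: AFFINE two-sided theorem of res-L1-w44b-stub-2
  (`KC3Lower.map_I_le_cohomologyAnnihilator`, p538224: `(x, y, z², zt, t²)·A′ ≤ ca(A′)`, `A′ = k[x,y,z,t]/(xy − z³ − t⁴)`, `2 ≠ 0`,
  fact-free: Jacobian + quotient ascent along the non-zero-divisor `x − y` + the conductor of `u² = z³ + t⁴`) transported to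
  `T₀` by res-type-010 `KC3Upper.mem_ca_loc_of_affine` (p537474; localisation [cite: IyengarTakahashi2014, Lemma 2.10 (1)] + the
  model `e₀`), then spanned out by res-type-010's adapter `KC3Glue.kc3_lower_subset_of_mem` («`ca` is an ideal»).
The valuation side conditions `v(x), v(y), v(z), v(t) < 1` are res-type-010's `KC3Glue.kc3_valuation_lt_one` (res-type-084 K3a).
No hypothesis on `k` beyond `(2 : k) ≠ 0` (the socket's `√-1 ∈ k` turned out to be unnecessary on stub-2's affine route).
-/

noncomputable section

-- single-problem summit: the doubled namespace component `ResolutionOfSingularities` is forced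
set_option linter.dupNamespace false

open MvPolynomial
open Summit.ResolutionOfSingularities.ResolutionOfSingularities.Theorems.NoZeno.Birth
open Summit.ResolutionOfSingularities.ResolutionOfSingularities.Theorems.HomologicalConductor.PersistenceMonomialValuation

namespace Summit.ResolutionOfSingularities.ResolutionOfSingularities.Theorems.HomologicalConductor.PersistenceKC3

variable (k : Type) [Field k]

/-- `K = k(x,z,t)`. -/
local notation3 "𝕂" => FractionRing (MvPolynomial (Fin 3) k)
/-- `x`. -/
local notation3 "𝔵" => algebraMap (MvPolynomial (Fin 3) k) (FractionRing (MvPolynomial (Fin 3) k)) (MvPolynomial.X 0)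
/-- `z`. -/
local notation3 "𝔷" => algebraMap (MvPolynomial (Fin 3) k) (FractionRing (MvPolynomial (Fin 3) k)) (MvPolynomial.X 1)
/-- `t`. -/
local notation3 "𝔱" => algebraMap (MvPolynomial (Fin 3) k) (FractionRing (MvPolynomial (Fin 3) k)) (MvPolynomial.X 2)
/-- `O = O_w`, `w = (6,5,4)`. -/
local notation3 "𝕆" => monomialValuationRing k (kc3Weight 1) (FractionRing (MvPolynomial (Fin 3) k))
/-- `A = k[x, z, t, (z³+t⁴)x⁻¹]`, spelled EXACTLY as in `kc3_tower_one_eq`. -/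
local notation3 "𝔸" => (Algebra.adjoin k
  ({algebraMap (MvPolynomial (Fin 3) k) (FractionRing (MvPolynomial (Fin 3) k)) (MvPolynomial.X 0),
    algebraMap (MvPolynomial (Fin 3) k) (FractionRing (MvPolynomial (Fin 3) k)) (MvPolynomial.X 1),
    algebraMap (MvPolynomial (Fin 3) k) (FractionRing (MvPolynomial (Fin 3) k)) (MvPolynomial.X 2),
    (algebraMap (MvPolynomial (Fin 3) k) (FractionRing (MvPolynomial (Fin 3) k)) (MvPolynomial.X 1) ^ 3 +
        algebraMap (MvPolynomial (Fin 3) k) (FractionRing (MvPolynomial (Fin 3) k)) (MvPolynomial.X 2) ^ 4) *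
      (algebraMap (MvPolynomial (Fin 3) k) (FractionRing (MvPolynomial (Fin 3) k)) (MvPolynomial.X 0))⁻¹} :
    Set (FractionRing (MvPolynomial (Fin 3) k))) : Subalgebra k (FractionRing (MvPolynomial (Fin 3) k)))

/-! ## §1 The five generators lie in `ca (loc O A)` -/

/-- Transport of one affine generator: if `b̄ ∈ (x,y,z²,zt,t²)·A′` then `b(x,y,z,t) ∈ ca (loc O A)` (stub-2's affine lower
bound + 010's localisation transport). [OURS · L1 w44b · K-C3 K2] -/
theorem kc3_aeval_mem_ca_loc (h2 : (2 : k) ≠ 0) {b : MvPolynomial (Fin 4) k}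
    (hb : b ∈ Ideal.span ({X 0, X 1, X 2 ^ 2, X 2 * X 3, X 3 ^ 2} : Set (MvPolynomial (Fin 4) k))) :
    MvPolynomial.aeval (R := k) (![𝔵, (𝔷 ^ 3 + 𝔱 ^ 4) * 𝔵⁻¹, 𝔷, 𝔱] : Fin 4 → 𝕂) b ∈ ca (loc 𝕆 𝔸) := by
  obtain ⟨hx, hy, hz, ht⟩ := KC3Glue.kc3_valuation_lt_one (k := k)
  exact KC3Upper.mem_ca_loc_of_affine k 𝕂 𝕆 (kc3_algebraMap_base_mem k 𝕂 1) hx hy hz ht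
    (KC3Lower.map_I_le_cohomologyAnnihilator k h2 (Ideal.mem_map_of_mem _ hb))

/-- `x ∈ ca (loc O A)`. [OURS · L1 w44b · K-C3 K2] -/
theorem kc3_x_mem_ca_loc' (h2 : (2 : k) ≠ 0) : (𝔵 : 𝕂) ∈ ca (loc 𝕆 𝔸) := by
  have h := kc3_aeval_mem_ca_loc k h2 (b := X 0) (Ideal.subset_span (by simp))
  simpa using h

/-- `y = (z³ + t⁴)x⁻¹ ∈ ca (loc O A)`. [OURS · L1 w44b · K-C3 K2] -/
theorem kc3_y_mem_ca_loc (h2 : (2 : k) ≠ 0) : ((𝔷 ^ 3 + 𝔱 ^ 4) * 𝔵⁻¹ : 𝕂) ∈ ca (loc 𝕆 𝔸) := by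
  have h := kc3_aeval_mem_ca_loc k h2 (b := X 1) (Ideal.subset_span (by simp))
  simpa using h

/-- `z² ∈ ca (loc O A)`. [OURS · L1 w44b · K-C3 K2] -/
theorem kc3_zz_mem_ca_loc (h2 : (2 : k) ≠ 0) : (𝔷 ^ 2 : 𝕂) ∈ ca (loc 𝕆 𝔸) := by
  have h := kc3_aeval_mem_ca_loc k h2 (b := X 2 ^ 2) (Ideal.subset_span (by simp))
  simpa using h

/-- `zt ∈ ca (loc O A)`. [OURS · L1 w44b · K-C3 K2] -/
theorem kc3_zt_mem_ca_loc (h2 : (2 : k) ≠ 0) : (𝔷 * 𝔱 : 𝕂) ∈ ca (loc 𝕆 𝔸) := by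
  have h := kc3_aeval_mem_ca_loc k h2 (b := X 2 * X 3) (Ideal.subset_span (by simp))
  simpa using h

/-- `t² ∈ ca (loc O A)`. [OURS · L1 w44b · K-C3 K2] -/
theorem kc3_tt_mem_ca_loc (h2 : (2 : k) ≠ 0) : (𝔱 ^ 2 : 𝕂) ∈ ca (loc 𝕆 𝔸) := by
  have h := kc3_aeval_mem_ca_loc k h2 (b := X 3 ^ 2) (Ideal.subset_span (by simp))
  simpa using h

/-! ## §2 The socket: `ca (loc O A) = (x, y, z², zt, t²)·loc O A` -/

/-- Ring-level form of a `ca`-membership (for 010's adapter). [cite: IyengarTakahashi2014, Definition 2.1] -/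
theorem mem_cohomologyAnnihilator_of_mem_ca {K' : Type} [Field K'] [Algebra k K'] (B : Subalgebra k K') {x : K'}
    (hx : x ∈ ca B) : ∀ h : x ∈ B, (⟨x, h⟩ : ↥B) ∈ Literature.RingTheory.CohomologyAnnihilator.cohomologyAnnihilator ↥B := by
  intro h
  have h' : ca B = ((↑) : ↥B → K') '' (Literature.RingTheory.CohomologyAnnihilator.cohomologyAnnihilator ↥B : Set ↥B) :=
    (Subalgebra.image_coe_cohomologyAnnihilator B).symm
  rw [h'] at hx
  obtain ⟨y, hy, hyx⟩ := hx
  have : y = ⟨x, h⟩ := Subtype.ext hyx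
  rwa [this] at hy

/-- **The lower bound at `T₀`**: `(x, y, z², zt, t²)·loc O A ⊆ ca (loc O A)`. [OURS · L1 w44b · K-C3 K2] -/
theorem kc3_lower_subset_ca_loc (h2 : (2 : k) ≠ 0) :
    {c : 𝕂 | ∃ α β γ δ ε : 𝕂, α ∈ loc 𝕆 𝔸 ∧ β ∈ loc 𝕆 𝔸 ∧ γ ∈ loc 𝕆 𝔸 ∧ δ ∈ loc 𝕆 𝔸 ∧ ε ∈ loc 𝕆 𝔸 ∧
        c = α * 𝔵 + β * ((𝔷 ^ 3 + 𝔱 ^ 4) * 𝔵⁻¹) + γ * 𝔷 ^ 2 + δ * (𝔷 * 𝔱) + ε * 𝔱 ^ 2} ⊆ ca (loc 𝕆 𝔸) :=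
  KC3Glue.kc3_lower_subset_of_mem 𝕆
    (mem_cohomologyAnnihilator_of_mem_ca k _ (kc3_x_mem_ca_loc' k h2))
    (mem_cohomologyAnnihilator_of_mem_ca k _ (kc3_y_mem_ca_loc k h2))
    (mem_cohomologyAnnihilator_of_mem_ca k _ (kc3_zz_mem_ca_loc k h2))
    (mem_cohomologyAnnihilator_of_mem_ca k _ (kc3_zt_mem_ca_loc k h2))
    (mem_cohomologyAnnihilator_of_mem_ca k _ (kc3_tt_mem_ca_loc k h2))

/-- **SOCKET K2 of the K5 skeleton (`stub_kc3_ca_loc_eq` of `kc3.lean`), CLOSED for every field `k` with `2 ≠ 0`**: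
`ca (loc O A) = {αx + βy + γz² + δzt + εt² : α, …, ε ∈ loc O A}` — 043's `hca` VERBATIM at `O = O_w`.
[OURS · L1 w44b · K-C3 K2] -/
theorem kc3_ca_loc_eq (h2 : (2 : k) ≠ 0) :
    ca (loc 𝕆 𝔸) =
      {c : 𝕂 | ∃ α β γ δ ε : 𝕂, α ∈ loc 𝕆 𝔸 ∧ β ∈ loc 𝕆 𝔸 ∧ γ ∈ loc 𝕆 𝔸 ∧ δ ∈ loc 𝕆 𝔸 ∧ ε ∈ loc 𝕆 𝔸 ∧
        c = α * 𝔵 + β * ((𝔷 ^ 3 + 𝔱 ^ 4) * 𝔵⁻¹) + γ * 𝔷 ^ 2 + δ * (𝔷 * 𝔱) + ε * 𝔱 ^ 2} := by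
  obtain ⟨hx, hy, hz, ht⟩ := KC3Glue.kc3_valuation_lt_one (k := k)
  exact Set.Subset.antisymm (KC3Upper.kc3_ca_loc_subset k 𝕂 𝕆 (kc3_algebraMap_base_mem k 𝕂 1) hx hy hz ht)
    (kc3_lower_subset_ca_loc k h2)

/-- The registered socket shape of `kc3.lean` (with the now-idle hypothesis `√-1 ∈ k`). [OURS · L1 w44b · K-C3 K2] -/
theorem stub_kc3_ca_loc_eq (h2 : (2 : k) ≠ 0) (_hi : ∃ i : k, i ^ 2 = -1) :
    ca (loc 𝕆 𝔸) =
      {c : 𝕂 | ∃ α β γ δ ε : 𝕂, α ∈ loc 𝕆 𝔸 ∧ β ∈ loc 𝕆 𝔸 ∧ γ ∈ loc 𝕆 𝔸 ∧ δ ∈ loc 𝕆 𝔸 ∧ ε ∈ loc 𝕆 𝔸 ∧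
        c = α * 𝔵 + β * ((𝔷 ^ 3 + 𝔱 ^ 4) * 𝔵⁻¹) + γ * 𝔷 ^ 2 + δ * (𝔷 * 𝔱) + ε * 𝔱 ^ 2} :=
  kc3_ca_loc_eq k h2

end Summit.ResolutionOfSingularities.ResolutionOfSingularities.Theorems.HomologicalConductor.PersistenceKC3

end
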